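import Summits.KontsevichZagierPeriods.KontsevichZagierPeriods.Theorems.LinRedNormalFormArrangementNormalFormStubRebaseSimpleZeroTwoDifferent

/-!
# Stub `stub_rebaseSimpleZeroTwo`, assembly (crux `ArrangementNormalForm`, line `janus-bands`) — part `TwoReduce`

NORMALISATION of the different-slope hypothesis `HDiff` of `rebaseSimpleZeroTwo_of_different'`
(a clean nest `A(y) < tᵢ < tⱼ < B(y)` over a one-dimensional base with a simple base pole at
`y = r`, both fibres lettered, letters of different `y`-slopes): it suffices to treat the nests
* whose INNER letter is constant and whose outer letter has non-zero `y`-slope (joint shear of both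
  fibres along the inner letter slope, rule 2: `RebaseNest.nest_shear`),
* whose fibres are non-empty over the WHOLE base cell, `A < B` on `cell M` (one base cut at the
  rational form `B − A`, rule 1a: `RebaseNest.nest_nonempty`; the other side has an empty domain),
* whose base cell lies on ONE SIDE of the pole, `r < y` on the cell or `y < r` on the cell (one
  base cut at `y = r`, rule 1a: `RebaseNest.nest_pole_side`).
Tools for arbitrary letters and an arbitrary target `S`: `RebaseNest.goodS_of_dom_empty`,
`RebaseNest.nest_rowSplit` (rule 1a on the base), `RebaseNest.nest_shear` and
`RebaseNest.nest_reflect` (rule 2 on both fibres). Main statements: `RebaseNest.hdiff_of_normal`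
(target `S`), the registered `rebaseSimpleZeroTwo_of_normalGGset` (literal binders) and the
stub-format closures `rebaseSimpleZeroTwo_of_normal'` / `rebaseSimpleZeroTwo_of_normalWide'`.

References: M. Kontsevich, D. Zagier, *Periods* (2001), §1.2, rules (1a), (2).
-/

noncomputable section

open Set MeasureTheory MvPolynomial
open Literature.NumberTheory.Transcendental Literature.ModelTheory.ExponentialFields

namespace Summit.KontsevichZagierPeriods.ArrangementNormalForm.JanusBands

namespace RebaseNest

open SeparatePos RebasePos RebaseZero

variable {S : Set KZ.FormalRep} {m m' : ℕ} {i j : Fin 2}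

/-! ### Tools for arbitrary letters and an arbitrary target -/

/-- A representation with empty domain is `S`-good. [folklore] -/
theorem goodS_of_dom_empty {n : ℕ} (r : KZ.IntegralRep n) (he : ∀ z, z ∉ r.domain) :
    ∃ c ∈ AddSubgroup.closure S, KZ.of r - c ∈ KZ.relations :=
  good_of_mem_relations (KZ.of_mem_relations_of_volume_eq_zero r
    (by rw [Set.eq_empty_of_forall_notMem he, measure_empty]))

/-- **Cutting the base cell at a rational form `q`** (rule 1a, `RebasePos.cutBase`; any bounds, any
integrand `f`, any target `S`): if both pieces (extra row `±q`) are `S`-good, so is `s`. -/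
theorem nest_rowSplit (s : KZ.IntegralRep (0 + 1 + 2)) (M : Fin m' → Cf) (lo hi : Fin 2 → Fin 2 ⊕ Cf)
    (f : (Fin (0 + 1 + 2) → ℝ) → ℝ) (hbd : Bornology.IsBounded s.domain)
    (hdom : s.domain = gDom 0 2 m' M lo hi) (hint : EqOn s.integrand f s.domain) (q : Cf) (hq : q ≠ 0)
    (h₁ : ∀ s₁ : KZ.IntegralRep (0 + 1 + 2), Bornology.IsBounded s₁.domain →
      s₁.domain = gDom 0 2 (m' + 1) (Fin.snoc M q : Fin (m' + 1) → Cf) lo hi → EqOn s₁.integrand f s₁.domain →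
      ∃ c ∈ AddSubgroup.closure S, KZ.of s₁ - c ∈ KZ.relations)
    (h₂ : ∀ s₂ : KZ.IntegralRep (0 + 1 + 2), Bornology.IsBounded s₂.domain →
      s₂.domain = gDom 0 2 (m' + 1) (Fin.snoc M (-q) : Fin (m' + 1) → Cf) lo hi → EqOn s₂.integrand f s₂.domain →
      ∃ c ∈ AddSubgroup.closure S, KZ.of s₂ - c ∈ KZ.relations) :
    ∃ c ∈ AddSubgroup.closure S, KZ.of s - c ∈ KZ.relations := by
  obtain ⟨s₁, s₂, hm₁, hm₂, hi₁, hi₂, hd₁, hd₂, hrel⟩ := cutBase s M lo hi hdom q hq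
  have hs₁ : s₁.domain ⊆ s.domain := fun z hz => ((hm₁ z).1 hz).1
  have hs₂ : s₂.domain ⊆ s.domain := fun z hz => ((hm₂ z).1 hz).1
  exact good_of_split hrel (h₁ s₁ (hbd.subset hs₁) hd₁ fun z hz => by rw [hi₁]; exact hint (hs₁ hz))
    (h₂ s₂ (hbd.subset hs₂) hd₂ fun z hz => by rw [hi₂]; exact hint (hs₂ hz))

/-- **Joint shear of both fibres along a slope `λ`** (rule 2, `tₗ ↦ tₗ + λ y`; arbitrary letters):
a clean nest stays a clean nest (bounds `A − λ y`, `B − λ y`), every letter loses the `y`-slope `λ`,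
the numerator picks up the rational constant `pullQ`. [Kontsevich–Zagier 2001, §1.2, rule (2)] -/
theorem nest_shear (s : KZ.IntegralRep (0 + 1 + 2)) (M : Fin m' → Cf) (L : Fin m → (Fin 0 → ℚ) × ℚ)
    (e : Fin m → ℕ) (p : MvPolynomial (Fin 0) ℚ) (ℓ₁ ℓ₂ : (Fin 0 → ℚ) × ℚ) (n₁ n₂ : ℕ) (a : Fin 2 → Option Cf)
    (A Bd : Cf) (hbd : Bornology.IsBounded s.domain) (hdom : s.domain = gDom 0 2 m' M (nlo i A) (nhi j Bd))
    (hint : EqOn s.integrand (glit 0 2 p L e ℓ₁ ℓ₂ n₁ n₂ a) s.domain) (lam : ℚ) :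
    ∃ s' : KZ.IntegralRep (0 + 1 + 2), Bornology.IsBounded s'.domain ∧
      s'.domain = gDom 0 2 m' M (nlo i (pullC 1 lam 0 A)) (nhi j (pullC 1 lam 0 Bd)) ∧
      EqOn s'.integrand (glit 0 2 (C (pullQ (fun _ : Fin 2 => (1 : ℚ)) a) * p) L e ℓ₁ ℓ₂ n₁ n₂
        (pullA (fun _ : Fin 2 => (1 : ℚ)) (fun _ => lam) (fun _ => 0) a)) s'.domain ∧
      KZ.of s - KZ.of s' ∈ KZ.relations := by
  obtain ⟨s', -, hbd', hdom', hint', hrel⟩ := pull (fun _ : Fin 2 => (1 : ℚ)) (fun _ => lam) (fun _ => 0)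
    s M L e p ℓ₁ ℓ₂ n₁ n₂ a (nlo i A) (nhi j Bd) hbd hdom hint (fun _ => one_ne_zero) (hlink_const 1 lam _ _)
  refine ⟨s', hbd', ?_, hint', hrel⟩
  rw [hdom', pullLo_shear, pullHi_shear]

/-- The letters after the joint shear: the same fibres are lettered, the slopes drop by `λ`. -/
theorem pullA_shear_some {a : Fin 2 → Option Cf} {lam : ℚ} {l : Fin 2} {c : Cf} (hc : a l = some c) :
    pullA (fun _ : Fin 2 => (1 : ℚ)) (fun _ => lam) (fun _ => 0) a l = some (pullC 1 lam 0 c) ∧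
      (pullC 1 lam 0 c).1 (Fin.last 0) = c.1 (Fin.last 0) - lam := by
  refine ⟨by simp only [pullA, hc, Option.map_some], ?_⟩
  rw [pullC_fst_last, div_one]

/-- **Reflection `t ↦ −t` of both fibres** (rule 2; arbitrary letters): the clean nest
`A < tᵢ < tⱼ < B` becomes the clean nest `−B < tⱼ < tᵢ < −A` (roles of the fibres exchanged), the
letters are negated. [Kontsevich–Zagier 2001, §1.2, rule (2)] -/
theorem nest_reflect (s : KZ.IntegralRep (0 + 1 + 2)) (M : Fin m' → Cf) (L : Fin m → (Fin 0 → ℚ) × ℚ)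
    (e : Fin m → ℕ) (p : MvPolynomial (Fin 0) ℚ) (ℓ₁ ℓ₂ : (Fin 0 → ℚ) × ℚ) (n₁ n₂ : ℕ) (a : Fin 2 → Option Cf)
    (hij : i ≠ j) (A Bd : Cf) (hbd : Bornology.IsBounded s.domain)
    (hdom : s.domain = gDom 0 2 m' M (nlo i A) (nhi j Bd))
    (hint : EqOn s.integrand (glit 0 2 p L e ℓ₁ ℓ₂ n₁ n₂ a) s.domain) :
    ∃ s' : KZ.IntegralRep (0 + 1 + 2), Bornology.IsBounded s'.domain ∧
      s'.domain = gDom 0 2 m' M (nlo j (-Bd)) (nhi i (-A)) ∧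
      EqOn s'.integrand (glit 0 2 (C (pullQ (fun _ : Fin 2 => (-1 : ℚ)) a) * p) L e ℓ₁ ℓ₂ n₁ n₂
        (fun l => (a l).map Neg.neg)) s'.domain ∧
      KZ.of s - KZ.of s' ∈ KZ.relations := by
  obtain ⟨s', -, hbd', hdom', hint', hrel⟩ := pull (fun _ : Fin 2 => (-1 : ℚ)) (fun _ => 0) (fun _ => 0)
    s M L e p ℓ₁ ℓ₂ n₁ n₂ a (nlo i A) (nhi j Bd) hbd hdom hint (fun _ => by norm_num) (hlink_const (-1) 0 _ _)
  have ha : pullA (fun _ : Fin 2 => (-1 : ℚ)) (fun _ => 0) (fun _ => 0) a = fun l => (a l).map Neg.neg := by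
    funext l; simp only [pullA, pullC_neg_one]
  refine ⟨s', hbd', ?_, ?_, hrel⟩
  · rw [hdom', pullLo_reflect hij, pullHi_reflect hij]
  · rw [← ha]; exact hint'

/-! ### The three normalisations -/

/-- **One side of the pole** (rule 1a): to prove a representation over the base cell `cell M`
`S`-good it suffices to prove `S`-good every representation with the same bounds and integrand over
a sub-cell lying entirely to the right or entirely to the left of the rational point `ρ` (cut the
base at `y = ρ`). [Kontsevich–Zagier 2001, §1.2, rule (1a)] -/
theorem nest_pole_side (ρ : ℚ) (f : (Fin (0 + 1 + 2) → ℝ) → ℝ) (lo hi : Fin 2 → Fin 2 ⊕ Cf)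
    (s : KZ.IntegralRep (0 + 1 + 2)) (M : Fin m' → Cf) (hbd : Bornology.IsBounded s.domain)
    (hdom : s.domain = gDom 0 2 m' M lo hi) (hint : EqOn s.integrand f s.domain)
    (H : ∀ (m₁ : ℕ) (M₁ : Fin m₁ → Cf) (r : KZ.IntegralRep (0 + 1 + 2)), (∀ y ∈ cell M₁, y ∈ cell M) →
      ((∀ y ∈ cell M₁, (ρ : ℝ) < y) ∨ (∀ y ∈ cell M₁, y < (ρ : ℝ))) →
      Bornology.IsBounded r.domain → r.domain = gDom 0 2 m₁ M₁ lo hi → EqOn r.integrand f r.domain →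
      ∃ c ∈ AddSubgroup.closure S, KZ.of r - c ∈ KZ.relations) :
    ∃ c ∈ AddSubgroup.closure S, KZ.of s - c ∈ KZ.relations := by
  refine nest_rowSplit s M lo hi f hbd hdom hint (RebaseZero.mk 1 (-ρ)) (mk_ne_zero one_ne_zero _)
    (fun s₁ hb₁ hd₁ hi₁ => H _ _ s₁ (fun y hy => ((mem_cell_snoc M _ y).1 hy).1) (Or.inl fun y hy => ?_) hb₁ hd₁ hi₁)
    (fun s₂ hb₂ hd₂ hi₂ => H _ _ s₂ (fun y hy => ((mem_cell_snoc M _ y).1 hy).1) (Or.inr fun y hy => ?_) hb₂ hd₂ hi₂)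
  · obtain ⟨-, h⟩ := (mem_cell_snoc M _ y).1 hy
    rw [ev_mk] at h
    push_cast at h
    linarith
  · obtain ⟨-, h⟩ := (mem_cell_snoc M _ y).1 hy
    rw [ev_neg, ev_mk] at h
    push_cast at h
    linarith

/-- **Non-empty fibres over the whole cell** (rule 1a): to prove a clean nest `A < tᵢ < tⱼ < B`
over `cell M` `S`-good it suffices to prove `S`-good every clean nest with the same bounds and
integrand over a sub-cell on which `A < B` (if `A = B` the domain is empty; else cut the base at the
rational form `B − A`: the side `B < A` has an empty domain). [Kontsevich–Zagier 2001, §1.2, rule (1a)] -/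
theorem nest_nonempty (f : (Fin (0 + 1 + 2) → ℝ) → ℝ) (hij : i ≠ j) (A Bd : Cf)
    (s : KZ.IntegralRep (0 + 1 + 2)) (M : Fin m' → Cf) (hbd : Bornology.IsBounded s.domain)
    (hdom : s.domain = gDom 0 2 m' M (nlo i A) (nhi j Bd)) (hint : EqOn s.integrand f s.domain)
    (H : ∀ (m₁ : ℕ) (M₁ : Fin m₁ → Cf) (r : KZ.IntegralRep (0 + 1 + 2)), (∀ y ∈ cell M₁, y ∈ cell M) →
      (∀ y ∈ cell M₁, ev A y < ev Bd y) →
      Bornology.IsBounded r.domain → r.domain = gDom 0 2 m₁ M₁ (nlo i A) (nhi j Bd) → EqOn r.integrand f r.domain →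
      ∃ c ∈ AddSubgroup.closure S, KZ.of r - c ∈ KZ.relations) :
    ∃ c ∈ AddSubgroup.closure S, KZ.of s - c ∈ KZ.relations := by
  by_cases hAB : Bd - A = 0
  · -- `A = B`: empty fibres
    have hE : Bd = A := sub_eq_zero.1 hAB
    refine goodS_of_dom_empty s fun z hz => ?_
    rw [hdom, mem_nDom hij, hE] at hz
    obtain ⟨-, h1, h2, h3⟩ := hz
    exact lt_irrefl _ ((h1.trans h2).trans h3)
  refine nest_rowSplit s M _ _ f hbd hdom hint (Bd - A) hAB
    (fun s₁ hb₁ hd₁ hi₁ => H _ _ s₁ (fun y hy => ((mem_cell_snoc M _ y).1 hy).1) (fun y hy => ?_) hb₁ hd₁ hi₁)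
    (fun s₂ _ hd₂ _ => goodS_of_dom_empty s₂ fun z hz => ?_)
  · obtain ⟨-, h⟩ := (mem_cell_snoc M _ y).1 hy
    rwa [ev_sub, sub_pos] at h
  · rw [hd₂, mem_nDom hij, mem_cell_snoc, ev_neg, ev_sub] at hz
    obtain ⟨⟨-, hr⟩, h1, h2, h3⟩ := hz
    linarith

/-- **Normalisation of the different-slope hypothesis.** For a target set `S`: if every clean nest
`A(y) < tᵢ < tⱼ < B(y)` with a literal `GS 0 2` integrand (exponents `0`, `1`) whose INNER letter
is constant (`cᵢ' = 0`), whose OUTER letter has non-zero `y`-slope, whose fibres are non-empty over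
the whole base cell (`A < B` on `cell M`) and whose base cell lies on one side of the base pole
`r = ℓ₂.2` is `S`-good (`hD₀`), then every clean nest both of whose fibres carry letters of
DIFFERENT `y`-slopes is `S`-good (the hypothesis `HDiff` of `rebaseSimpleZeroTwo_of_different'`
with target `S`): joint shear along the inner letter slope (`nest_shear`), then `nest_nonempty` and
`nest_pole_side`. [Kontsevich–Zagier 2001, §1.2, rules (1a), (2)] -/
theorem hdiff_of_normal
    (hD₀ : ∀ (m m' : ℕ) (s : KZ.IntegralRep (0 + 1 + 2)) (M : Fin m' → (Fin (0 + 1) → ℚ) × ℚ)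
      (L : Fin m → (Fin 0 → ℚ) × ℚ) (e : Fin m → ℕ) (p : MvPolynomial (Fin 0) ℚ) (ℓ₁ ℓ₂ : (Fin 0 → ℚ) × ℚ)
      (a : Fin 2 → Option ((Fin (0 + 1) → ℚ) × ℚ)) (lo hi : Fin 2 → Fin 2 ⊕ ((Fin (0 + 1) → ℚ) × ℚ)) (i j : Fin 2)
      (A B ci cj : (Fin (0 + 1) → ℚ) × ℚ),
      i ≠ j → lo i = Sum.inr A → hi i = Sum.inl j → lo j = Sum.inl i → hi j = Sum.inr B →
      a i = some ci → a j = some cj → ci.1 (Fin.last 0) = 0 → cj.1 (Fin.last 0) ≠ 0 →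
      (∀ y ∈ cell M, ev A y < ev B y) →
      ((∀ y ∈ cell M, (ℓ₂.2 : ℝ) < y) ∨ (∀ y ∈ cell M, y < (ℓ₂.2 : ℝ))) →
      Bornology.IsBounded s.domain → s.domain = gDom 0 2 m' M lo hi →
      EqOn s.integrand (glit 0 2 p L e ℓ₁ ℓ₂ 0 1 a) s.domain →
      ∃ c ∈ AddSubgroup.closure S, KZ.of s - c ∈ KZ.relations)
    (m m' : ℕ) (s : KZ.IntegralRep (0 + 1 + 2)) (M : Fin m' → Cf) (L : Fin m → (Fin 0 → ℚ) × ℚ)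
    (e : Fin m → ℕ) (p : MvPolynomial (Fin 0) ℚ) (ℓ₁ ℓ₂ : (Fin 0 → ℚ) × ℚ) (a : Fin 2 → Option Cf)
    (lo hi : Fin 2 → Fin 2 ⊕ Cf) (i j : Fin 2) (A B ci cj : Cf) (hij : i ≠ j) (hloi : lo i = Sum.inr A)
    (hhii : hi i = Sum.inl j) (hloj : lo j = Sum.inl i) (hhij : hi j = Sum.inr B) (hai : a i = some ci)
    (haj : a j = some cj) (hne : ci.1 (Fin.last 0) ≠ cj.1 (Fin.last 0)) (hbd : Bornology.IsBounded s.domain)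
    (hdom : s.domain = gDom 0 2 m' M lo hi) (hint : EqOn s.integrand (glit 0 2 p L e ℓ₁ ℓ₂ 0 1 a) s.domain) :
    ∃ c ∈ AddSubgroup.closure S, KZ.of s - c ∈ KZ.relations := by
  obtain ⟨hlo, hhi⟩ := eq_nlo_nhi hij hloi hhii hloj hhij
  subst hlo hhi
  -- joint shear along the inner letter slope
  obtain ⟨s', hbd', hdom', hint', hrel⟩ := nest_shear s M L e p ℓ₁ ℓ₂ 0 1 a A B hbd hdom hint (ci.1 (Fin.last 0))
  obtain ⟨hai', hci'⟩ := pullA_shear_some (lam := ci.1 (Fin.last 0)) hai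
  obtain ⟨haj', hcj'⟩ := pullA_shear_some (lam := ci.1 (Fin.last 0)) haj
  refine good_of_sub_mem hrel ?_
  -- non-empty fibres, then one side of the pole
  refine nest_nonempty _ hij _ _ s' M hbd' hdom' hint' fun m₁ M₁ r _ hAB hb hd hi' => ?_
  refine nest_pole_side ℓ₂.2 _ _ _ r M₁ hb hd hi' fun m₂ M₂ r' hsub hside hb' hd' hi'' => ?_
  exact hD₀ m m₂ r' M₂ L e _ ℓ₁ ℓ₂ _ _ _ i j _ _ _ _ hij (nlo_self i _) (nhi_of_ne hij _) (nlo_of_ne hij _)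
    (nhi_self j _) hai' haj' (by rw [hci', sub_self]) (by rw [hcj']; exact sub_ne_zero.2 hne.symm)
    (fun y hy => hAB y (hsub y hy)) hside hb' hd' hi''

end RebaseNest

/-- **The two-fibre rebase on the literal class, conditionally on the NORMALISED different-slope
hypothesis** (registered part of `stub_rebaseSimpleZeroTwo`, line `janus-bands`, literal binders).
A representation with a literal `GS 0 2` datum (`n₂ = 1`, hence `n₁ = 0`) is congruent modulo
`KZ.relations` to a `ℤ`-combination of elements of the rebased literal class
`SeparatePos.GGset 0 2 2`, PROVIDED (`HDiff₀`) so is every clean nest `A(y) < tᵢ < tⱼ < B(y)` whose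
inner letter is CONSTANT, whose outer letter has NON-ZERO `y`-slope, whose fibres are non-empty
over the whole base cell (`A < B` on `RebaseZero.cell M`) and whose base cell lies on one side of
the base pole `ℓ₂.2`. Proof: `rebaseSimpleZeroTwo_of_differentGGset` with
`RebaseNest.hdiff_of_normal` (joint shear, two base cuts). [Kontsevich–Zagier 2001, §1.2, rules (1a), (2)] -/
theorem rebaseSimpleZeroTwo_of_normalGGset (HDiff₀ : ∀ (m m' : ℕ) (s : KZ.IntegralRep (0 + 1 + 2)) (M : Fin m' → (Fin (0 + 1) → ℚ) × ℚ) (L : Fin m → (Fin 0 → ℚ) × ℚ) (e : Fin m → ℕ) (p : MvPolynomial (Fin 0) ℚ) (ℓ₁ ℓ₂ : (Fin 0 → ℚ) × ℚ) (a : Fin 2 → Option ((Fin (0 + 1) → ℚ) × ℚ)) (lo hi : Fin 2 → Fin 2 ⊕ ((Fin (0 + 1) → ℚ) × ℚ)) (i j : Fin 2) (A B ci cj : (Fin (0 + 1) → ℚ) × ℚ), i ≠ j → lo i = Sum.inr A → hi i = Sum.inl j → lo j = Sum.inl i → hi j = Sum.inr B → a i = some ci → a j = some cj → ci.1 (Fin.last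 0) = 0 → cj.1 (Fin.last 0) ≠ 0 → (∀ y ∈ RebaseZero.cell M, RebaseZero.ev A y < RebaseZero.ev B y) → ((∀ y ∈ RebaseZero.cell M, (ℓ₂.2 : ℝ) < y) ∨ (∀ y ∈ RebaseZero.cell M, y < (ℓ₂.2 : ℝ))) → Bornology.IsBounded s.domain → s.domain = SeparatePos.gDom 0 2 m' M lo hi → EqOn s.integrand (RebasePos.glit 0 2 p L e ℓ₁ ℓ₂ 0 1 a) s.domain → ∃ c ∈ AddSubgroup.closure (SeparatePos.GGset 0 2 2), KZ.of s - c ∈ KZ.relations) (m m' n₁ n₂ : ℕ) (s : KZ.IntegralRep (0 + 1 + 2)) (M : Fin m' → (Fin (0 + 1) → ℚ) × ℚ) (L : Fin m → (Fin 0 → ℚ) × ℚ) (e : Fin m → ℕ) (p : MvPolynomial (Fin 0) ℚ) (ℓ₁ ℓ₂ : (Fin 0 → ℚ) × ℚ) (a : Fin 2 → Option ((Fin (0 + 1) → ℚ) × ℚ)) (lo hi : Fin 2 → Fin 2 ⊕ ((Fin (0 + 1) → ℚ) × ℚ)) (h12 : n₁ = 0 ∨ n₂ = 0) (hn : n₂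 = 1) (hbd : Bornology.IsBounded s.domain) (hdom : s.domain = SeparatePos.gDom 0 2 m' M lo hi) (hint : EqOn s.integrand (RebasePos.glit 0 2 p L e ℓ₁ ℓ₂ n₁ n₂ a) s.domain) : ∃ c ∈ AddSubgroup.closure (SeparatePos.GGset 0 2 2), KZ.of s - c ∈ KZ.relations :=
  rebaseSimpleZeroTwo_of_differentGGset (RebaseNest.hdiff_of_normal HDiff₀) m m' n₁ n₂ s M L e p ℓ₁ ℓ₂ a lo hi h12 hn
    hbd hdom hint

/-- **`stub_rebaseSimpleZeroTwo` conditionally on the NORMALISED NARROW different-slope hypothesis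
`HDiff₀`** (line `janus-bands`): as `rebaseSimpleZeroTwo_of_different'`, but the clean nests with
letters of different `y`-slopes need only be treated in normal form (inner letter constant, outer
letter of non-zero `y`-slope, non-empty fibres over the whole base cell, base cell on one side of
the base pole; `RebaseNest.hdiff_of_normal`). The defining equations of `JJ`, `JD` are not needed.
[Kontsevich–Zagier 2001, §1.2, rules (1a), (1b), (2)] -/
theorem rebaseSimpleZeroTwo_of_normal' (GS : ℕ → ℕ → Set KZ.FormalRep) (GG : ℕ → ℕ → ℕ → Set KZ.FormalRep) (hGS : ∀ b k, GS b k = {w : KZ.FormalRep | ∃ (m m' n₁ n₂ : ℕ) (s : KZ.IntegralRep (b + 1 + k)) (M : Fin m' → (Fin (b + 1) → ℚ) × ℚ) (L : Fin m → (Fin b → ℚ) × ℚ) (e : Fin m → ℕ) (p : MvPolynomial (Fin b) ℚ) (ℓ₁ ℓ₂ : (Fin b → ℚ) × ℚ) (a : Fin k → Option ((Fin (b + 1) → ℚ) × ℚ)) (lo hi : Fin k → Fin k ⊕ ((Fin (b + 1) → ℚ) × ℚ)), (n₁ = 0 ∨ n₂ = 0) ∧ n₂ = 1 ∧ Bornology.IsBounded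 s.domain ∧ s.domain = {z | (∀ j, 0 < ∑ i, ((M j).1 i : ℝ) * z (Fin.castAdd k i) + ((M j).2 : ℝ)) ∧ ∀ i, Sum.elim (fun j => z (Fin.natAdd (b + 1) j)) (fun c => ∑ i', (c.1 i' : ℝ) * z (Fin.castAdd k i') + (c.2 : ℝ)) (lo i) < z (Fin.natAdd (b + 1) i) ∧ z (Fin.natAdd (b + 1) i) < Sum.elim (fun j => z (Fin.natAdd (b + 1) j)) (fun c => ∑ i', (c.1 i' : ℝ) * z (Fin.castAdd k i') + (c.2 : ℝ)) (hi i)} ∧ EqOn s.integrand (fun z => MvPolynomial.aeval (fun i => z (Fin.castAdd k (Fin.castSucc i))) p / (∏ j, (∑ i, ((L j).1 i : ℝ) * z (Fin.castAdd k (Fin.castSucc i)) + ((L j).2 : ℝ)) ^ e j) * ((z (Fin.castAdd k (Fin.last b)) - (∑ i, (ℓ₁.1 i : ℝ) * z (Fin.castAdd k (Fin.castSucc i)) + (ℓ₁.2 : ℝ))) ^ n₁ / (z (Fin.castAdd k (Fin.last b)) - (∑ i, (ℓ₂.1 i : ℝ) * z (Fin.castAdd k (Fin.castSucc i)) + (ℓ₂.2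 : ℝ))) ^ n₂) * ∏ i, (a i).elim 1 (fun c => 1 / (z (Fin.natAdd (b + 1) i) - (∑ i', (c.1 i' : ℝ) * z (Fin.castAdd k i') + (c.2 : ℝ))))) s.domain ∧ w = KZ.of s}) (hGG : ∀ b σ k, GG b σ k = {w : KZ.FormalRep | ∃ (m m' n₁ n₂ : ℕ) (s : KZ.IntegralRep (b + 1 + k)) (M : Fin m' → (Fin (b + 1) → ℚ) × ℚ) (L : Fin m → (Fin b → ℚ) × ℚ) (e : Fin m → ℕ) (p : MvPolynomial (Fin b) ℚ) (ℓ₁ ℓ₂ : (Fin b → ℚ) × ℚ) (a : Fin k → Option ((Fin (b + 1) → ℚ) × ℚ)) (lo hi : Fin k → Fin k ⊕ ((Fin (b + 1) → ℚ) × ℚ)), (n₁ = 0 ∨ n₂ = 0) ∧ (σ = 2 → (∀ i c, a i = some c → c.1 (Fin.last b) = 0) ∧ (∀ i c, (lo i = Sum.inr c ∨ hi i = Sum.inr c) → (c.1 (Fin.last b) = 0 ∨ c = (Pi.single (Fin.last b) 1, 0)))) ∧ Bornology.IsBounded s.domain ∧ s.domain = {z | (∀ j, 0 < ∑ i, ((M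 j).1 i : ℝ) * z (Fin.castAdd k i) + ((M j).2 : ℝ)) ∧ ∀ i, Sum.elim (fun j => z (Fin.natAdd (b + 1) j)) (fun c => ∑ i', (c.1 i' : ℝ) * z (Fin.castAdd k i') + (c.2 : ℝ)) (lo i) < z (Fin.natAdd (b + 1) i) ∧ z (Fin.natAdd (b + 1) i) < Sum.elim (fun j => z (Fin.natAdd (b + 1) j)) (fun c => ∑ i', (c.1 i' : ℝ) * z (Fin.castAdd k i') + (c.2 : ℝ)) (hi i)} ∧ EqOn s.integrand (fun z => MvPolynomial.aeval (fun i => z (Fin.castAdd k (Fin.castSucc i))) p / (∏ j, (∑ i, ((L j).1 i : ℝ) * z (Fin.castAdd k (Fin.castSucc i)) + ((L j).2 : ℝ)) ^ e j) * ((z (Fin.castAdd k (Fin.last b)) - (∑ i, (ℓ₁.1 i : ℝ) * z (Fin.castAdd k (Fin.castSucc i)) + (ℓ₁.2 : ℝ))) ^ n₁ / (z (Fin.castAdd k (Fin.last b)) - (∑ i, (ℓ₂.1 i : ℝ) * z (Fin.castAdd k (Fin.castSucc i)) + (ℓ₂.2 : ℝ))) ^ n₂) * ∏ i, (a i).elim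 1 (fun c => 1 / (z (Fin.natAdd (b + 1) i) - (∑ i', (c.1 i' : ℝ) * z (Fin.castAdd k i') + (c.2 : ℝ))))) s.domain ∧ w = KZ.of s}) (JJ : ℕ → ℕ → Set KZ.FormalRep) (JD : ℕ → Set KZ.FormalRep) (hJJ : ∀ b k, JJ b k = {w : KZ.FormalRep | ∃ (m m' : ℕ) (s : KZ.IntegralRep (b + k)) (M : Fin m' → (Fin b → ℚ) × ℚ) (L : Fin m → (Fin b → ℚ) × ℚ) (e : Fin m → ℕ) (p : MvPolynomial (Fin b) ℚ) (a : Fin k → Option ((Fin b → ℚ) × ℚ)) (lo hi : Fin k → Fin k ⊕ ((Fin b → ℚ) × ℚ)), Bornology.IsBounded s.domain ∧ s.domain = {z | (∀ j, 0 < ∑ i, ((M j).1 i : ℝ) * z (Fin.castAdd k i) + ((M j).2 : ℝ)) ∧ ∀ i, Sum.elim (fun j => z (Fin.natAdd b j)) (fun c => ∑ i', (c.1 i' : ℝ) * z (Fin.castAdd k i') + (c.2 : ℝ)) (lo i) < z (Fin.natAdd b i) ∧ z (Fin.natAdd b i) < Sum.elim (fun j => z (Fin.natAdd b j)) (fun c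 => ∑ i', (c.1 i' : ℝ) * z (Fin.castAdd k i') + (c.2 : ℝ)) (hi i)} ∧ EqOn s.integrand (fun z => MvPolynomial.aeval (fun i => z (Fin.castAdd k i)) p / (∏ j, (∑ i, ((L j).1 i : ℝ) * z (Fin.castAdd k i) + ((L j).2 : ℝ)) ^ e j) * ∏ i, (a i).elim 1 (fun c => 1 / (z (Fin.natAdd b i) - (∑ i', (c.1 i' : ℝ) * z (Fin.castAdd k i') + (c.2 : ℝ))))) s.domain ∧ w = KZ.of s}) (hJD : ∀ N, JD N = {w : KZ.FormalRep | ∃ b' k', b' + k' = N ∧ w ∈ JJ b' k'}) (HDiff₀ : ∀ (m m' : ℕ) (s : KZ.IntegralRep (0 + 1 + 2)) (M : Fin m' → (Fin (0 + 1) → ℚ) × ℚ) (L : Fin m → (Fin 0 → ℚ) × ℚ) (e : Fin m → ℕ) (p : MvPolynomial (Fin 0) ℚ) (ℓ₁ ℓ₂ : (Fin 0 → ℚ) × ℚ) (a : Fin 2 → Option ((Fin (0 + 1) → ℚ) × ℚ)) (lo hi : Fin 2 → Fin 2 ⊕ ((Fin (0 + 1) → ℚ) × ℚ)) (i j : Fin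 2) (A B ci cj : (Fin (0 + 1) → ℚ) × ℚ), i ≠ j → lo i = Sum.inr A → hi i = Sum.inl j → lo j = Sum.inl i → hi j = Sum.inr B → a i = some ci → a j = some cj → ci.1 (Fin.last 0) = 0 → cj.1 (Fin.last 0) ≠ 0 → (∀ y ∈ RebaseZero.cell M, RebaseZero.ev A y < RebaseZero.ev B y) → ((∀ y ∈ RebaseZero.cell M, (ℓ₂.2 : ℝ) < y) ∨ (∀ y ∈ RebaseZero.cell M, y < (ℓ₂.2 : ℝ))) → Bornology.IsBounded s.domain → s.domain = SeparatePos.gDom 0 2 m' M lo hi → EqOn s.integrand (RebasePos.glit 0 2 p L e ℓ₁ ℓ₂ 0 1 a) s.domain → ∃ c ∈ AddSubgroup.closure (SeparatePos.GGset 0 2 2), KZ.of s - c ∈ KZ.relations) : ∀ x ∈ GS 0 2, ∃ c ∈ AddSubgroup.closure (GG 0 2 2 ∪ JJ 0 3 ∪ JD 2), x - c ∈ KZ.relations :=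
  rebaseSimpleZeroTwo_of_different' GS GG hGS hGG JJ JD hJJ hJD (RebaseNest.hdiff_of_normal HDiff₀)

/-- **`stub_rebaseSimpleZeroTwo` conditionally on the NORMALISED WIDE different-slope hypothesis
`HDiff₀`** (line `janus-bands`): as `rebaseSimpleZeroTwo_of_differentWide'` (target of the
hypothesis = the stub's own target `GG 0 2 2 ∪ JJ 0 3 ∪ JD 2`), with the clean nests in normal form
(inner letter constant, outer letter of non-zero `y`-slope, non-empty fibres over the whole base
cell, base cell on one side of the base pole; `RebaseNest.hdiff_of_normal`). The defining equations
of `JJ`, `JD` are not needed. [Kontsevich–Zagier 2001, §1.2, rules (1a), (1b), (2)] -/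
theorem rebaseSimpleZeroTwo_of_normalWide' (GS : ℕ → ℕ → Set KZ.FormalRep) (GG : ℕ → ℕ → ℕ → Set KZ.FormalRep) (hGS : ∀ b k, GS b k = {w : KZ.FormalRep | ∃ (m m' n₁ n₂ : ℕ) (s : KZ.IntegralRep (b + 1 + k)) (M : Fin m' → (Fin (b + 1) → ℚ) × ℚ) (L : Fin m → (Fin b → ℚ) × ℚ) (e : Fin m → ℕ) (p : MvPolynomial (Fin b) ℚ) (ℓ₁ ℓ₂ : (Fin b → ℚ) × ℚ) (a : Fin k → Option ((Fin (b + 1) → ℚ) × ℚ)) (lo hi : Fin k → Fin k ⊕ ((Fin (b + 1) → ℚ) × ℚ)), (n₁ = 0 ∨ n₂ = 0) ∧ n₂ = 1 ∧ Bornology.IsBounded s.domain ∧ s.domain = {z | (∀ j, 0 < ∑ i, ((M j).1 i : ℝ) * z (Fin.castAdd k i) + ((M j).2 : ℝ)) ∧ ∀ i, Sum.elim (fun j => z (Fin.natAdd (b + 1) j)) (fun c => ∑ i', (c.1 i' : ℝ) * z (Fin.castAdd k i') + (c.2 : ℝ)) (lo i) < z (Fin.natAdd (b + 1) i) ∧ z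 (Fin.natAdd (b + 1) i) < Sum.elim (fun j => z (Fin.natAdd (b + 1) j)) (fun c => ∑ i', (c.1 i' : ℝ) * z (Fin.castAdd k i') + (c.2 : ℝ)) (hi i)} ∧ EqOn s.integrand (fun z => MvPolynomial.aeval (fun i => z (Fin.castAdd k (Fin.castSucc i))) p / (∏ j, (∑ i, ((L j).1 i : ℝ) * z (Fin.castAdd k (Fin.castSucc i)) + ((L j).2 : ℝ)) ^ e j) * ((z (Fin.castAdd k (Fin.last b)) - (∑ i, (ℓ₁.1 i : ℝ) * z (Fin.castAdd k (Fin.castSucc i)) + (ℓ₁.2 : ℝ))) ^ n₁ / (z (Fin.castAdd k (Fin.last b)) - (∑ i, (ℓ₂.1 i : ℝ) * z (Fin.castAdd k (Fin.castSucc i)) + (ℓ₂.2 : ℝ))) ^ n₂) * ∏ i, (a i).elim 1 (fun c => 1 / (z (Fin.natAdd (b + 1) i) - (∑ i', (c.1 i' : ℝ) * z (Fin.castAdd k i') + (c.2 : ℝ))))) s.domain ∧ w = KZ.of s}) (hGG : ∀ b σ k, GG b σ k = {w : KZ.FormalRep | ∃ (m m' n₁ n₂ : ℕ) (s : KZ.IntegralRep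 (b + 1 + k)) (M : Fin m' → (Fin (b + 1) → ℚ) × ℚ) (L : Fin m → (Fin b → ℚ) × ℚ) (e : Fin m → ℕ) (p : MvPolynomial (Fin b) ℚ) (ℓ₁ ℓ₂ : (Fin b → ℚ) × ℚ) (a : Fin k → Option ((Fin (b + 1) → ℚ) × ℚ)) (lo hi : Fin k → Fin k ⊕ ((Fin (b + 1) → ℚ) × ℚ)), (n₁ = 0 ∨ n₂ = 0) ∧ (σ = 2 → (∀ i c, a i = some c → c.1 (Fin.last b) = 0) ∧ (∀ i c, (lo i = Sum.inr c ∨ hi i = Sum.inr c) → (c.1 (Fin.last b) = 0 ∨ c = (Pi.single (Fin.last b) 1, 0)))) ∧ Bornology.IsBounded s.domain ∧ s.domain = {z | (∀ j, 0 < ∑ i, ((M j).1 i : ℝ) * z (Fin.castAdd k i) + ((M j).2 : ℝ)) ∧ ∀ i, Sum.elim (fun j => z (Fin.natAdd (b + 1) j)) (fun c => ∑ i', (c.1 i' : ℝ) * z (Fin.castAdd k i') + (c.2 : ℝ)) (lo i) < z (Fin.natAdd (b + 1) i) ∧ z (Fin.natAdd (b + 1) i) < Sum.elim (fun j => z (Fin.natAdd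 (b + 1) j)) (fun c => ∑ i', (c.1 i' : ℝ) * z (Fin.castAdd k i') + (c.2 : ℝ)) (hi i)} ∧ EqOn s.integrand (fun z => MvPolynomial.aeval (fun i => z (Fin.castAdd k (Fin.castSucc i))) p / (∏ j, (∑ i, ((L j).1 i : ℝ) * z (Fin.castAdd k (Fin.castSucc i)) + ((L j).2 : ℝ)) ^ e j) * ((z (Fin.castAdd k (Fin.last b)) - (∑ i, (ℓ₁.1 i : ℝ) * z (Fin.castAdd k (Fin.castSucc i)) + (ℓ₁.2 : ℝ))) ^ n₁ / (z (Fin.castAdd k (Fin.last b)) - (∑ i, (ℓ₂.1 i : ℝ) * z (Fin.castAdd k (Fin.castSucc i)) + (ℓ₂.2 : ℝ))) ^ n₂) * ∏ i, (a i).elim 1 (fun c => 1 / (z (Fin.natAdd (b + 1) i) - (∑ i', (c.1 i' : ℝ) * z (Fin.castAdd k i') + (c.2 : ℝ))))) s.domain ∧ w = KZ.of s}) (JJ : ℕ → ℕ → Set KZ.FormalRep) (JD : ℕ → Set KZ.FormalRep) (hJJ : ∀ b k, JJ b k = {w : KZ.FormalRep | ∃ (m m' : ℕ) (s : KZ.IntegralRep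 (b + k)) (M : Fin m' → (Fin b → ℚ) × ℚ) (L : Fin m → (Fin b → ℚ) × ℚ) (e : Fin m → ℕ) (p : MvPolynomial (Fin b) ℚ) (a : Fin k → Option ((Fin b → ℚ) × ℚ)) (lo hi : Fin k → Fin k ⊕ ((Fin b → ℚ) × ℚ)), Bornology.IsBounded s.domain ∧ s.domain = {z | (∀ j, 0 < ∑ i, ((M j).1 i : ℝ) * z (Fin.castAdd k i) + ((M j).2 : ℝ)) ∧ ∀ i, Sum.elim (fun j => z (Fin.natAdd b j)) (fun c => ∑ i', (c.1 i' : ℝ) * z (Fin.castAdd k i') + (c.2 : ℝ)) (lo i) < z (Fin.natAdd b i) ∧ z (Fin.natAdd b i) < Sum.elim (fun j => z (Fin.natAdd b j)) (fun c => ∑ i', (c.1 i' : ℝ) * z (Fin.castAdd k i') + (c.2 : ℝ)) (hi i)} ∧ EqOn s.integrand (fun z => MvPolynomial.aeval (fun i => z (Fin.castAdd k i)) p / (∏ j, (∑ i, ((L j).1 i : ℝ) * z (Fin.castAdd k i) + ((L j).2 : ℝ)) ^ e j) * ∏ i, (a i).elim 1 (fun c => 1 / (z (Fin.natAdd b i)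 - (∑ i', (c.1 i' : ℝ) * z (Fin.castAdd k i') + (c.2 : ℝ))))) s.domain ∧ w = KZ.of s}) (hJD : ∀ N, JD N = {w : KZ.FormalRep | ∃ b' k', b' + k' = N ∧ w ∈ JJ b' k'}) (HDiff₀ : ∀ (m m' : ℕ) (s : KZ.IntegralRep (0 + 1 + 2)) (M : Fin m' → (Fin (0 + 1) → ℚ) × ℚ) (L : Fin m → (Fin 0 → ℚ) × ℚ) (e : Fin m → ℕ) (p : MvPolynomial (Fin 0) ℚ) (ℓ₁ ℓ₂ : (Fin 0 → ℚ) × ℚ) (a : Fin 2 → Option ((Fin (0 + 1) → ℚ) × ℚ)) (lo hi : Fin 2 → Fin 2 ⊕ ((Fin (0 + 1) → ℚ) × ℚ)) (i j : Fin 2) (A B ci cj : (Fin (0 + 1) → ℚ) × ℚ), i ≠ j → lo i = Sum.inr A → hi i = Sum.inl j → lo j = Sum.inl i → hi j = Sum.inr B → a i = some ci → a j = some cj → ci.1 (Fin.last 0) = 0 → cj.1 (Fin.last 0) ≠ 0 → (∀ y ∈ RebaseZero.cell M, RebaseZero.ev A y < RebaseZero.ev B y) → ((∀ y ∈ RebaseZero.cell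 M, (ℓ₂.2 : ℝ) < y) ∨ (∀ y ∈ RebaseZero.cell M, y < (ℓ₂.2 : ℝ))) → Bornology.IsBounded s.domain → s.domain = SeparatePos.gDom 0 2 m' M lo hi → EqOn s.integrand (RebasePos.glit 0 2 p L e ℓ₁ ℓ₂ 0 1 a) s.domain → ∃ c ∈ AddSubgroup.closure (GG 0 2 2 ∪ JJ 0 3 ∪ JD 2), KZ.of s - c ∈ KZ.relations) : ∀ x ∈ GS 0 2, ∃ c ∈ AddSubgroup.closure (GG 0 2 2 ∪ JJ 0 3 ∪ JD 2), x - c ∈ KZ.relations :=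
  rebaseSimpleZeroTwo_of_differentWide' GS GG hGS hGG JJ JD hJJ hJD (RebaseNest.hdiff_of_normal HDiff₀)

end Summit.KontsevichZagierPeriods.ArrangementNormalForm.JanusBands
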